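import Mathlib.LinearAlgebra.Matrix.SchurComplement
import Mathlib.LinearAlgebra.Matrix.Block
import Mathlib.Data.Matrix.Basis
import Literature.Computability.AlgebraicComplexity.DeterminantalComplexity
import HarnessLib

/-!
# Determinantal complexity: padding and power sums

Sibling proofs file of `Literature/Computability/AlgebraicComplexity/DeterminantalComplexity.lean`.

* `Literature.Computability.AlgebraicComplexity.HasDetRepr.mono_holds` discharges the named fact `HasDetRepr.mono`: an affine
  determinantal representation of size `m` can be padded to any size `m' ≥ m` (block-diagonal
  sum with an identity matrix).
* `Literature.Computability.AlgebraicComplexity.hasDetRepr_sum_X_pow`: the power sum `X_1^s + ⋯ + X_k^s` has an affine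
  determinantal representation of every size `n ≥ max 1 (s k)` — the determinantal-complexity
  input of Bürgisser–Ikenmeyer–Panova 2019, Thm. 2.5 ("Writing the power sum `X_1^s + ⋯ + X_k^s`
  as a formula requires at most `sk - 1` many additions and multiplications. Valiant's
  construction implies that `X_1^s + ⋯ + X_k^s` has determinantal complexity at most `sk`").
  Instead of Valiant's general formula-to-determinant construction we give the resulting matrix
  directly: starting from the `1 × 1` zero matrix, each term `x^s` (`s = t + 2 ≥ 2`) is adjoined
  as a bordered block
  `[[A, -x E_{z,0}], [x E_{t,z}, U]]` with `U = 1 - x N` the unipotent upper bidiagonal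
  `(t+1) × (t+1)` matrix (`N` the shift); by the Schur complement formula
  (`Matrix.det_fromBlocks₂₂`, `U⁻¹ = ∑ xⁱ Nⁱ` has corner entry `x^t`) the determinant changes
  exactly as if `x^{t+2}` were added to the entry `(z, z)` of `A`, whose cofactor is kept equal
  to `1`. The sizes are `1 + (s - 1) k ≤ max 1 (s k)`; `s ≤ 1` is the affine case.

## Sources

* L. G. Valiant, *Completeness classes in algebra*, STOC 1979, §2 (universality of the
  determinant for formulas) (key `Valiant1979`).
* T. Mignon, N. Ressayre, *A quadratic bound for the determinant and permanent problem*,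
  IMRN 2004, §1 (affine determinantal representations, padding) (key `MignonRessayre2004`).
* P. Bürgisser, C. Ikenmeyer, G. Panova, *No occurrence obstructions in geometric complexity
  theory*, J. AMS 32 (2019) = arXiv:1604.06431v3, proof of Thm. 2.5
  (key `BurgisserIkenmeyerPanovaJAMS2019`).
-/

noncomputable section

open MvPolynomial Matrix

namespace Literature.Computability.AlgebraicComplexity

variable {k : Type*} [CommRing k] {σ : Type*}

/-! ### Padding: `HasDetRepr.mono` -/

/-- **Discharge of `HasDetRepr.mono`**: pad an affine determinantal representation `A` of size
`m` to size `m' = m + c` by the block-diagonal matrix `A ⊕ 1_c` (reindexed along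
`Fin m ⊕ Fin c ≃ Fin (m + c)`); its entries are those of `A`, `0` or `1`, and its determinant is
`det A`. Mignon–Ressayre 2004, §1. [cite: MignonRessayre2004, §1] -/
theorem HasDetRepr.mono_holds : HasDetRepr.mono (k := k) (σ := σ) := by
  intro f m m' h hm
  obtain ⟨A, hA, hdet⟩ := h
  obtain ⟨c, rfl⟩ := Nat.exists_eq_add_of_le hm
  refine ⟨Matrix.reindex finSumFinEquiv finSumFinEquiv (Matrix.fromBlocks A 0 0 1), ?_, ?_⟩
  · intro i j
    rw [Matrix.reindex_apply, Matrix.submatrix_apply]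
    generalize finSumFinEquiv.symm i = a
    generalize finSumFinEquiv.symm j = b
    rcases a with a | a <;> rcases b with b | b
    · simpa using hA a b
    · simp
    · simp
    · simp only [Matrix.fromBlocks_apply₂₂, Matrix.one_apply]
      split_ifs <;> simp
  · rw [Matrix.det_reindex_self, Matrix.det_fromBlocks_zero₂₁, Matrix.det_one, mul_one, hdet]

/-! ### Power sums: an explicit determinantal representation of `x_1^s + ⋯ + x_k^s` -/

section PowerSum

variable {R : Type*} [CommRing R]

/-! The auxiliary matrices are introduced through characterising hypotheses (`hU`, `hW`), not
as definitions: `U = 1 - y N` is the unipotent upper bidiagonal matrix of size `n` (`N` the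
nilpotent shift: `U a a = 1`, `U a (a+1) = -y`, all other entries `0`), and `W = ∑_{i<n} yⁱ Nⁱ`
(`W a b = y^(b-a)` for `a ≤ b`, else `0`) is its inverse. -/

/-- `U W = 1` for the unipotent bidiagonal `U = 1 - y N` and `W = ∑ yⁱ Nⁱ`: row `a` of the
product is `W a · - y W (a+1) ·`. [folklore] -/
theorem chainU_mul_chainW {n : ℕ} (y : R) {U W : Matrix (Fin n) (Fin n) R}
    (hU : ∀ a b, U a b = if (b : ℕ) = a then 1 else if (b : ℕ) = a + 1 then -y else 0)
    (hW : ∀ a b, W a b = if (a : ℕ) ≤ b then y ^ ((b : ℕ) - a) else 0) : U * W = 1 := by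
  ext a b
  rw [Matrix.mul_apply, Matrix.one_apply]
  -- split off the (at most two) nonzero terms `c = a` and `c = a + 1`
  have hsplit : ∀ c : Fin n, U a c * W c b =
      (if c = a then W a b else 0) + (if (c : ℕ) = a + 1 then -y * W c b else 0) := by
    intro c
    by_cases hca : c = a
    · subst hca
      rw [hU, if_pos rfl, one_mul, if_pos rfl, if_neg (by omega), add_zero]
    · have hca' : (c : ℕ) ≠ a := fun h => hca (Fin.ext h)
      by_cases hc1 : (c : ℕ) = a + 1
      · rw [hU, if_neg hca', if_pos hc1, if_neg hca, if_pos hc1, zero_add]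
      · rw [hU, if_neg hca', if_neg hc1, zero_mul, if_neg hca, if_neg hc1, add_zero]
  rw [Finset.sum_congr rfl fun c _ => hsplit c, Finset.sum_add_distrib, Finset.sum_ite_eq',
    if_pos (Finset.mem_univ a)]
  by_cases hlast : (a : ℕ) + 1 < n
  · -- the second term is present, at `c = ⟨a + 1, hlast⟩`
    rw [Finset.sum_eq_single (⟨(a : ℕ) + 1, hlast⟩ : Fin n) (fun c _ hc => if_neg fun h =>
      hc (Fin.ext h)) (fun h => absurd (Finset.mem_univ _) h), if_pos rfl, hW, hW]
    by_cases hab : a = b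
    · subst hab
      rw [if_pos rfl, if_pos le_rfl, if_neg (by simp), Nat.sub_self, pow_zero, mul_zero,
        add_zero]
    · rw [if_neg hab]
      have hab' : (a : ℕ) ≠ b := fun h => hab (Fin.ext h)
      by_cases hle : (a : ℕ) ≤ b
      · have hlt : (a : ℕ) + 1 ≤ b := by omega
        rw [if_pos hle, if_pos hlt]
        have : (b : ℕ) - a = ((b : ℕ) - (a + 1)) + 1 := by omega
        rw [this, pow_succ]
        ring
      · have hlt : ¬ ((a : ℕ) + 1 ≤ b) := by omega
        rw [if_neg hle, if_neg hlt]
        ring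
  · -- last row: no `c = a + 1`
    rw [Finset.sum_eq_zero fun c _ => if_neg fun h => hlast (by have := c.2; omega), add_zero,
      hW]
    by_cases hab : a = b
    · subst hab
      rw [if_pos rfl, if_pos le_rfl, Nat.sub_self, pow_zero]
    · rw [if_neg hab]
      have : ¬ ((a : ℕ) ≤ b) := fun h => hab (Fin.ext (by have := b.2; omega))
      rw [if_neg this]

/-- `det U = 1` for the upper unitriangular `U = 1 - y N`. [folklore] -/
theorem det_chainU {n : ℕ} (y : R) {U : Matrix (Fin n) (Fin n) R}
    (hU : ∀ a b, U a b = if (b : ℕ) = a then 1 else if (b : ℕ) = a + 1 then -y else 0) :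
    U.det = 1 := by
  rw [Matrix.det_of_upperTriangular]
  · exact Finset.prod_eq_one fun a _ => by rw [hU, if_pos rfl]
  · intro a b hab
    have hlt : (b : ℕ) < a := hab
    have h1 : (b : ℕ) ≠ a := by omega
    have h2 : (b : ℕ) ≠ a + 1 := by omega
    rw [hU, if_neg h1, if_neg h2]

/-- **Determinant of the bordering step.** Adjoin to `A` (with distinguished index `z`) the
blocks `B = -y E_{z,0}`, `C = y E_{t,z}` (`t` the last index) and `U = 1 - y N` of size `t + 1`:
then `det ([[A, B], [C, U]] + c E_{z,z}) = det (A + (c + y^(t+2)) E_{z,z})` — the new block acts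
as adding `y^(t+2)` to the `(z, z)` entry. Schur complement with respect to the invertible block
`U` (`Matrix.det_fromBlocks₂₂`; `B U⁻¹ C = -y · W 0 t · y E_{z,z} = -y^(t+2) E_{z,z}`).
[folklore] -/
theorem det_border_add_single {ι : Type*} [Fintype ι] [DecidableEq ι] (A : Matrix ι ι R)
    (z : ι) {t : ℕ} (y c : R) {U W : Matrix (Fin (t + 1)) (Fin (t + 1)) R}
    (hU : ∀ a b, U a b = if (b : ℕ) = a then 1 else if (b : ℕ) = a + 1 then -y else 0)
    (hW : ∀ a b, W a b = if (a : ℕ) ≤ b then y ^ ((b : ℕ) - a) else 0) :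
    (Matrix.fromBlocks A (Matrix.single z (0 : Fin (t + 1)) (-y))
        (Matrix.single (Fin.last t) z y) U + Matrix.single (Sum.inl z) (Sum.inl z) c).det =
      (A + Matrix.single z z (c + y ^ (t + 2))).det := by
  have hsingle : (Matrix.single (Sum.inl z) (Sum.inl z) c :
      Matrix (ι ⊕ Fin (t + 1)) (ι ⊕ Fin (t + 1)) R) =
      Matrix.fromBlocks (Matrix.single z z c) 0 0 0 := by
    ext p q
    rcases p with p | p <;> rcases q with q | q <;> simp [Matrix.single_apply]
  have hschur : Matrix.single z (0 : Fin (t + 1)) (-y) * W * Matrix.single (Fin.last t) z y =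
      Matrix.single z z (-(y ^ (t + 2))) := by
    rw [Matrix.single_mul_mul_single, hW]
    congr 1
    simp only [Fin.val_zero, Fin.val_last, zero_le, if_true, Nat.sub_zero]
    ring
  letI : Invertible U := invertibleOfRightInverse _ _ (chainU_mul_chainW y hU hW)
  have hinv : ⅟U = W := rfl
  rw [hsingle, Matrix.fromBlocks_add, add_zero, add_zero, add_zero, Matrix.det_fromBlocks₂₂,
    det_chainU y hU, one_mul, hinv, hschur, sub_eq_add_neg, ← Matrix.single_neg, neg_neg,
    add_assoc, ← Matrix.single_add]

/-- **The bordered power-sum matrices.** For affine `x 0, x 1, …` (total degree `≤ 1`) and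
every `j` there is a square matrix `M` of size `1 + (t+1) j` with affine entries and a
distinguished index `z` such that `det (M + c E_{z,z}) = c + ∑_{i<j} (x i)^(t+2)` for all `c`
(in particular `det M = ∑_{i<j} (x i)^(t+2)`, and the `(z,z)` cofactor is `1`). Induction on
`j` by `det_border_add_single` (bordering with `y = x j`), starting from the `1 × 1` zero
matrix; the entries are entries of the previous matrix or `0, 1, x j, -x j`.
Bürgisser–Ikenmeyer–Panova 2019, proof of Thm. 2.5 (there via Valiant 1979).
[cite: BurgisserIkenmeyerPanovaJAMS2019, Thm. 2.5] -/
theorem exists_matrix_det_eq_sum_pow (t : ℕ) (x : ℕ → MvPolynomial σ k)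
    (hx : ∀ i, (x i).totalDegree ≤ 1) (j : ℕ) :
    ∃ (ι : Type) (_ : Fintype ι) (_ : DecidableEq ι) (z : ι)
      (M : Matrix ι ι (MvPolynomial σ k)),
      Fintype.card ι = 1 + (t + 1) * j ∧ (∀ p q, (M p q).totalDegree ≤ 1) ∧
        ∀ c, (M + Matrix.single z z c).det =
          c + ∑ i ∈ Finset.range j, x i ^ (t + 2) := by
  induction j with
  | zero =>
    refine ⟨Unit, inferInstance, inferInstance, (), 0, by simp, fun p q => by simp, fun c => ?_⟩
    simp [Matrix.det_unique]
  | succ j ih =>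
    obtain ⟨ι, _, _, z, M, hcard, hdeg, hdet⟩ := ih
    -- the bordering blocks for `y = x j`
    let U : Matrix (Fin (t + 1)) (Fin (t + 1)) (MvPolynomial σ k) := Matrix.of fun a b =>
      if (b : ℕ) = a then 1 else if (b : ℕ) = a + 1 then -x j else 0
    let W : Matrix (Fin (t + 1)) (Fin (t + 1)) (MvPolynomial σ k) := Matrix.of fun a b =>
      if (a : ℕ) ≤ b then x j ^ ((b : ℕ) - a) else 0
    have hU : ∀ a b, U a b = if (b : ℕ) = a then 1 else if (b : ℕ) = a + 1 then -x j else 0 :=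
      fun a b => rfl
    have hW : ∀ a b, W a b = if (a : ℕ) ≤ b then x j ^ ((b : ℕ) - a) else 0 := fun a b => rfl
    refine ⟨ι ⊕ Fin (t + 1), inferInstance, inferInstance, Sum.inl z,
      Matrix.fromBlocks M (Matrix.single z (0 : Fin (t + 1)) (-x j))
        (Matrix.single (Fin.last t) z (x j)) U, ?_, ?_, fun c => ?_⟩
    · rw [Fintype.card_sum, Fintype.card_fin, hcard]
      ring
    · rintro (p | p) (q | q)
      · rw [Matrix.fromBlocks_apply₁₁]
        exact hdeg p q
      · rw [Matrix.fromBlocks_apply₁₂, Matrix.single_apply]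
        split_ifs
        · rw [totalDegree_neg]
          exact hx j
        · simp
      · rw [Matrix.fromBlocks_apply₂₁, Matrix.single_apply]
        split_ifs
        · exact hx j
        · simp
      · rw [Matrix.fromBlocks_apply₂₂, hU]
        split_ifs
        · simp
        · rw [totalDegree_neg]
          exact hx j
        · simp
    · rw [det_border_add_single M z (x j) c hU hW, hdet, Finset.sum_range_succ]
      ring

/-- **Power sums have small determinantal complexity**: for `s k ≤ n` and `1 ≤ n`, the power
sum `X_0^s + ⋯ + X_{k-1}^s ∈ k[X_0, …, X_{k-1}]` has an affine determinantal representation of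
size `n`. (`s ≥ 2`: the bordered matrices of size `1 + (s-1) k ≤ max 1 (s k)`, padded;
`s ≤ 1`: the polynomial is affine, a `1 × 1` determinant, padded.) This is the
determinantal-complexity step of Bürgisser–Ikenmeyer–Panova 2019, proof of Thm. 2.5
("`X_1^s + ⋯ + X_k^s` has determinantal complexity at most `sk ≤ n`", there via Valiant's
construction). [cite: BurgisserIkenmeyerPanovaJAMS2019, Thm. 2.5] -/
theorem hasDetRepr_sum_X_pow (s kk n : ℕ) (hn : s * kk ≤ n) (hn1 : 1 ≤ n) :
    HasDetRepr (∑ i : Fin kk, (X i : MvPolynomial (Fin kk) k) ^ s) n := by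
  rcases Nat.lt_or_ge s 2 with hs | hs
  · -- affine case `s ≤ 1`: a `1 × 1` determinant
    refine HasDetRepr.mono_holds
      ⟨Matrix.of fun _ _ => ∑ i : Fin kk, (X i : MvPolynomial (Fin kk) k) ^ s,
        fun i j => ?_, by simp [Matrix.det_unique]⟩ hn1
    simp only [Matrix.of_apply]
    refine totalDegree_finsetSum_le fun i _ => (totalDegree_pow _ _).trans ?_
    calc s * (X i : MvPolynomial (Fin kk) k).totalDegree ≤ 1 * 1 :=
        Nat.mul_le_mul (by omega) (isHomogeneous_X k i).totalDegree_le
      _ = 1 := rfl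
  · -- `s = t + 2`
    obtain ⟨t, rfl⟩ : ∃ t, s = t + 2 := ⟨s - 2, by omega⟩
    set x : ℕ → MvPolynomial (Fin kk) k := fun i => if h : i < kk then X ⟨i, h⟩ else 0
      with hxdef
    have hx : ∀ i, (x i).totalDegree ≤ 1 := by
      intro i
      simp only [hxdef]
      split_ifs
      · exact (isHomogeneous_X k _).totalDegree_le
      · simp
    obtain ⟨ι, _, _, z, M, hcard, hdeg, hdet⟩ := exists_matrix_det_eq_sum_pow t x hx kk
    -- reindex to `Fin (1 + (t+1) kk)` and pad to `n`
    have hsize : 1 + (t + 1) * kk ≤ n := by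
      rcases Nat.eq_zero_or_pos kk with rfl | hk
      · simpa using hn1
      · have : (t + 2) * kk = (t + 1) * kk + kk := by ring
        omega
    refine HasDetRepr.mono_holds ⟨Matrix.reindex (Fintype.equivFinOfCardEq hcard)
      (Fintype.equivFinOfCardEq hcard) M, fun i j => ?_, ?_⟩ hsize
    · rw [Matrix.reindex_apply, Matrix.submatrix_apply]
      exact hdeg _ _
    · rw [Matrix.det_reindex_self]
      have h0 := hdet 0
      rw [Matrix.single_zero, add_zero, zero_add] at h0
      rw [h0, ← Fin.sum_univ_eq_sum_range (fun i => x i ^ (t + 2)) kk]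
      refine Finset.sum_congr rfl fun i _ => ?_
      simp [hxdef, i.2]

end PowerSum

end Literature.Computability.AlgebraicComplexity

/-! ## Appendix (2026-08-14): Valiant universality and the degree bound

Discharges of the named facts `exists_hasDetRepr` (Valiant 1979, Thm. 1: every polynomial is
the determinant of a matrix of affine linear forms), `hasDetRepr_determinantalComplexity`,
`hasDetRepr_iff_determinantalComplexity_le`, `totalDegree_le_of_hasDetRepr` and
`totalDegree_le_determinantalComplexity` of `DeterminantalComplexity.lean`.

The universality proof is the algebraic-branching-program construction in matrix form: a
*gadget* for `g` is an affine square matrix `M` with a distinguished index `z` such that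
`det (M + c E_{z,z}) = c + g` for all `c` (i.e. `det M = g` and the `(z,z)` cofactor is `1`).
The `1 × 1` zero matrix is a gadget for `0`; adding an affine form to the entry `(z,z)` adds it
to `g`; and bordering with the path block `[[M, -y₀ E_{z,0}], [y_{t+1} E_{t,z}, 1 - N_y]]`
(`N_y` the shift with superdiagonal `y₁, …, y_t`) adds the product `y₀ y₁ ⋯ y_{t+1}` of `t + 2`
affine forms (Schur complement, `det_pathBorder_add_single`, generalising
`det_border_add_single` above from powers `y^{t+2}` to arbitrary products). Induction on `f`
(`MvPolynomial.induction_on`) then adds `f · ∏ l` for any list `l` of affine forms.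

Sources: L. G. Valiant, *Completeness classes in algebra*, STOC 1979, Thm. 1 and §2
(key `ValiantSTOC1979`); P. Bürgisser, *Completeness and reduction in algebraic complexity
theory* (2000), Prop. 2.30, §2.5; T. Mignon, N. Ressayre, IMRN 2004, §1 (key `MignonRessayre2004`).
-/

namespace Literature.Computability.AlgebraicComplexity

variable {k : Type*} [CommRing k] {σ : Type*}

/-! ### Valiant universality: every polynomial is an affine determinant -/

section Universality

variable {R : Type*} [CommRing R]

/-- `U W = 1` for the unipotent bidiagonal `U = 1 - N_y` with superdiagonal entries
`U a (a+1) = -y (a+1)` and `W a b = ∏_{a < i ≤ b} y i` (`a ≤ b`, else `0`): row `a` of the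
product is `W a · - y (a+1) W (a+1) ·`. [folklore] -/
theorem pathU_mul_pathW {n : ℕ} (y : ℕ → R) {U W : Matrix (Fin n) (Fin n) R}
    (hU : ∀ a b, U a b = if (b : ℕ) = a then 1 else if (b : ℕ) = a + 1 then -y b else 0)
    (hW : ∀ a b, W a b = if (a : ℕ) ≤ b then ∏ i ∈ Finset.Ioc (a : ℕ) b, y i else 0) :
    U * W = 1 := by
  have hIoc : ∀ a' b' : ℕ, a' < b' →
      Finset.Ioc a' b' = insert (a' + 1) (Finset.Ioc (a' + 1) b') := by
    intro a' b' h
    ext i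
    simp only [Finset.mem_Ioc, Finset.mem_insert]
    omega
  ext a b
  rw [Matrix.mul_apply, Matrix.one_apply]
  -- split off the (at most two) nonzero terms `c = a` and `c = a + 1`
  have hsplit : ∀ c : Fin n, U a c * W c b =
      (if c = a then W a b else 0) + (if (c : ℕ) = a + 1 then -y c * W c b else 0) := by
    intro c
    by_cases hca : c = a
    · subst hca
      rw [hU, if_pos rfl, one_mul, if_pos rfl, if_neg (by omega), add_zero]
    · have hca' : (c : ℕ) ≠ a := fun h => hca (Fin.ext h)
      by_cases hc1 : (c : ℕ) = a + 1
      · rw [hU, if_neg hca', if_pos hc1, if_neg hca, if_pos hc1, zero_add]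
      · rw [hU, if_neg hca', if_neg hc1, zero_mul, if_neg hca, if_neg hc1, add_zero]
  rw [Finset.sum_congr rfl fun c _ => hsplit c, Finset.sum_add_distrib, Finset.sum_ite_eq',
    if_pos (Finset.mem_univ a)]
  by_cases hlast : (a : ℕ) + 1 < n
  · -- the second term is present, at `c = ⟨a + 1, hlast⟩`
    rw [Finset.sum_eq_single (⟨(a : ℕ) + 1, hlast⟩ : Fin n) (fun c _ hc => if_neg fun h =>
      hc (Fin.ext h)) (fun h => absurd (Finset.mem_univ _) h), if_pos rfl, hW, hW]
    by_cases hab : a = b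
    · subst hab
      rw [if_pos rfl, if_pos le_rfl, if_neg (by simp), Finset.Ioc_self, Finset.prod_empty,
        mul_zero, add_zero]
    · rw [if_neg hab]
      have hab' : (a : ℕ) ≠ b := fun h => hab (Fin.ext h)
      by_cases hle : (a : ℕ) ≤ b
      · have hlt : (a : ℕ) + 1 ≤ b := by omega
        rw [if_pos hle, if_pos hlt, hIoc a b (by omega), Finset.prod_insert (by simp)]
        ring
      · have hlt : ¬ ((a : ℕ) + 1 ≤ b) := by omega
        rw [if_neg hle, if_neg hlt]
        ring
  · -- last row: no `c = a + 1`
    rw [Finset.sum_eq_zero fun c _ => if_neg fun h => hlast (by have := c.2; omega), add_zero,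
      hW]
    by_cases hab : a = b
    · subst hab
      rw [if_pos rfl, if_pos le_rfl, Finset.Ioc_self, Finset.prod_empty]
    · rw [if_neg hab]
      have : ¬ ((a : ℕ) ≤ b) := fun h => hab (Fin.ext (by have := b.2; omega))
      rw [if_neg this]

/-- `det U = 1` for the upper unitriangular `U = 1 - N_y`. [folklore] -/
theorem det_pathU {n : ℕ} (y : ℕ → R) {U : Matrix (Fin n) (Fin n) R}
    (hU : ∀ a b, U a b = if (b : ℕ) = a then 1 else if (b : ℕ) = a + 1 then -y b else 0) :
    U.det = 1 := by
  rw [Matrix.det_of_upperTriangular]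
  · exact Finset.prod_eq_one fun a _ => by rw [hU, if_pos rfl]
  · intro a b hab
    have hlt : (b : ℕ) < a := hab
    have h1 : (b : ℕ) ≠ a := by omega
    have h2 : (b : ℕ) ≠ a + 1 := by omega
    rw [hU, if_neg h1, if_neg h2]

/-- `∏_{i < t+2} y i = y 0 · (∏_{0 < i ≤ t} y i) · y (t+1)`. [folklore] -/
theorem prod_range_add_two_eq (y : ℕ → R) (t : ℕ) :
    ∏ i ∈ Finset.range (t + 2), y i = y 0 * (∏ i ∈ Finset.Ioc 0 t, y i) * y (t + 1) := by
  induction t with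
  | zero => simp [Finset.prod_range_succ]
  | succ t ih =>
    rw [Finset.prod_range_succ, ih, Finset.prod_Ioc_succ_top (Nat.zero_le _)]
    ring

/-- **Determinant of the path-bordering step.** Adjoin to `A` (with distinguished index `z`)
the blocks `B = -y₀ E_{z,0}`, `C = y_{t+1} E_{t,z}` (`t` the last index) and the unipotent
bidiagonal `U = 1 - N_y` of size `t + 1` (superdiagonal `-y_1, …, -y_t`): then
`det ([[A, B], [C, U]] + c E_{z,z}) = det (A + (c + y_0 y_1 ⋯ y_{t+1}) E_{z,z})` — the new block
acts as adding the path monomial `∏_{i<t+2} y_i` to the `(z, z)` entry (in the language of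
algebraic branching programs: a new path of `t + 2` edges from `z` back to `z`). Schur
complement with respect to the invertible block `U` (`Matrix.det_fromBlocks₂₂`;
`B U⁻¹ C = -y_0 · W 0 t · y_{t+1} E_{z,z}`). Valiant 1979, §2. [cite: ValiantSTOC1979, §2] -/
theorem det_pathBorder_add_single {ι : Type*} [Fintype ι] [DecidableEq ι] (A : Matrix ι ι R)
    (z : ι) {t : ℕ} (y : ℕ → R) (c : R) {U W : Matrix (Fin (t + 1)) (Fin (t + 1)) R}
    (hU : ∀ a b, U a b = if (b : ℕ) = a then 1 else if (b : ℕ) = a + 1 then -y b else 0)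
    (hW : ∀ a b, W a b = if (a : ℕ) ≤ b then ∏ i ∈ Finset.Ioc (a : ℕ) b, y i else 0) :
    (Matrix.fromBlocks A (Matrix.single z (0 : Fin (t + 1)) (-y 0))
        (Matrix.single (Fin.last t) z (y (t + 1))) U +
        Matrix.single (Sum.inl z) (Sum.inl z) c).det =
      (A + Matrix.single z z (c + ∏ i ∈ Finset.range (t + 2), y i)).det := by
  have hsingle : (Matrix.single (Sum.inl z) (Sum.inl z) c :
      Matrix (ι ⊕ Fin (t + 1)) (ι ⊕ Fin (t + 1)) R) =
      Matrix.fromBlocks (Matrix.single z z c) 0 0 0 := by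
    ext p q
    rcases p with p | p <;> rcases q with q | q <;> simp [Matrix.single_apply]
  have hschur : Matrix.single z (0 : Fin (t + 1)) (-y 0) * W *
      Matrix.single (Fin.last t) z (y (t + 1)) =
      Matrix.single z z (-(∏ i ∈ Finset.range (t + 2), y i)) := by
    rw [Matrix.single_mul_mul_single, hW, prod_range_add_two_eq]
    congr 1
    simp only [Fin.val_zero, Fin.val_last, zero_le, if_true]
    ring
  letI : Invertible U := invertibleOfRightInverse _ _ (pathU_mul_pathW y hU hW)
  have hinv : ⅟U = W := rfl
  rw [hsingle, Matrix.fromBlocks_add, add_zero, add_zero, add_zero, Matrix.det_fromBlocks₂₂,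
    det_pathU y hU, one_mul, hinv, hschur, sub_eq_add_neg, ← Matrix.single_neg, neg_neg,
    add_assoc, ← Matrix.single_add]

/-! #### Gadgets: affine matrices `M` with a distinguished index `z` of cofactor `1`

The invariant `∃ ι z M, (entries affine) ∧ ∀ c, det (M + c E_{z,z}) = c + g` says that `M` is an
affine matrix with `det M = g` whose `(z, z)` cofactor is `1` (an algebraic branching program
with source and sink glued at `z`). It holds for `g = 0` (the `1 × 1` zero matrix), is stable
under adding an affine form to `g` (add it to the entry `(z, z)`), and under adding a product of
at least two affine forms (`det_pathBorder_add_single`). -/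

/-- The `1 × 1` zero matrix is a gadget for `0`. [folklore] -/
theorem exists_gadget_zero :
    ∃ (ι : Type) (_ : Fintype ι) (_ : DecidableEq ι) (z : ι) (M : Matrix ι ι (MvPolynomial σ k)),
      (∀ p q, (M p q).totalDegree ≤ 1) ∧ ∀ c, (M + Matrix.single z z c).det = c + 0 :=
  ⟨Unit, inferInstance, inferInstance, (), 0, fun p q => by simp, fun c => by
    simp [Matrix.det_unique]⟩

/-- Adding an affine form `a` to a gadget for `g` (at the entry `(z, z)`) gives a gadget for
`g + a`. [folklore] -/
theorem exists_gadget_add_affine {g a : MvPolynomial σ k} (ha : a.totalDegree ≤ 1)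
    (h : ∃ (ι : Type) (_ : Fintype ι) (_ : DecidableEq ι) (z : ι)
      (M : Matrix ι ι (MvPolynomial σ k)),
      (∀ p q, (M p q).totalDegree ≤ 1) ∧ ∀ c, (M + Matrix.single z z c).det = c + g) :
    ∃ (ι : Type) (_ : Fintype ι) (_ : DecidableEq ι) (z : ι) (M : Matrix ι ι (MvPolynomial σ k)),
      (∀ p q, (M p q).totalDegree ≤ 1) ∧ ∀ c, (M + Matrix.single z z c).det = c + (g + a) := by
  obtain ⟨ι, _, _, z, M, hdeg, hdet⟩ := h
  refine ⟨ι, inferInstance, inferInstance, z, M + Matrix.single z z a, fun p q => ?_,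
    fun c => ?_⟩
  · rw [Matrix.add_apply, Matrix.single_apply]
    split_ifs
    · exact (totalDegree_add _ _).trans (max_le (hdeg p q) ha)
    · rw [add_zero]
      exact hdeg p q
  · rw [add_assoc, ← Matrix.single_add, hdet]
    ring

/-- Adding a product `y_0 y_1 ⋯ y_{t+1}` of at least two affine forms to a gadget for `g` gives
a gadget for `g + ∏_{i<t+2} y_i`: border by the path block of `det_pathBorder_add_single`
(with `y = (y_i)`); the new entries are `0`, `1`, `± y_i`. Valiant 1979, §2 (universality of
the determinant). [cite: ValiantSTOC1979, §2] -/
theorem exists_gadget_add_prod {g : MvPolynomial σ k} (y : ℕ → MvPolynomial σ k)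
    (hy : ∀ i, (y i).totalDegree ≤ 1) (t : ℕ)
    (h : ∃ (ι : Type) (_ : Fintype ι) (_ : DecidableEq ι) (z : ι)
      (M : Matrix ι ι (MvPolynomial σ k)),
      (∀ p q, (M p q).totalDegree ≤ 1) ∧ ∀ c, (M + Matrix.single z z c).det = c + g) :
    ∃ (ι : Type) (_ : Fintype ι) (_ : DecidableEq ι) (z : ι) (M : Matrix ι ι (MvPolynomial σ k)),
      (∀ p q, (M p q).totalDegree ≤ 1) ∧
        ∀ c, (M + Matrix.single z z c).det = c + (g + ∏ i ∈ Finset.range (t + 2), y i) := by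
  obtain ⟨ι, _, _, z, M, hdeg, hdet⟩ := h
  let U : Matrix (Fin (t + 1)) (Fin (t + 1)) (MvPolynomial σ k) := Matrix.of fun a b =>
    if (b : ℕ) = a then 1 else if (b : ℕ) = a + 1 then -y b else 0
  let W : Matrix (Fin (t + 1)) (Fin (t + 1)) (MvPolynomial σ k) := Matrix.of fun a b =>
    if (a : ℕ) ≤ b then ∏ i ∈ Finset.Ioc (a : ℕ) b, y i else 0
  have hU : ∀ a b, U a b = if (b : ℕ) = a then 1 else if (b : ℕ) = a + 1 then -y b else 0 :=
    fun a b => rfl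
  have hW : ∀ a b, W a b = if (a : ℕ) ≤ b then ∏ i ∈ Finset.Ioc (a : ℕ) b, y i else 0 :=
    fun a b => rfl
  refine ⟨ι ⊕ Fin (t + 1), inferInstance, inferInstance, Sum.inl z,
    Matrix.fromBlocks M (Matrix.single z (0 : Fin (t + 1)) (-y 0))
      (Matrix.single (Fin.last t) z (y (t + 1))) U, ?_, fun c => ?_⟩
  · rintro (p | p) (q | q)
    · rw [Matrix.fromBlocks_apply₁₁]
      exact hdeg p q
    · rw [Matrix.fromBlocks_apply₁₂, Matrix.single_apply]
      split_ifs
      · rw [totalDegree_neg]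
        exact hy 0
      · simp
    · rw [Matrix.fromBlocks_apply₂₁, Matrix.single_apply]
      split_ifs
      · exact hy (t + 1)
      · simp
    · rw [Matrix.fromBlocks_apply₂₂, hU]
      split_ifs
      · simp
      · rw [totalDegree_neg]
        exact hy q
      · simp
  · rw [det_pathBorder_add_single M z y c hU hW, hdet]
    ring

/-- `∏_{i < |l|} l.getD i 1 = l.prod`. [folklore] -/
theorem prod_range_getD_one {M : Type*} [CommMonoid M] (l : List M) :
    ∏ i ∈ Finset.range l.length, l.getD i 1 = l.prod := by
  induction l with
  | nil => simp
  | cons x xs ih =>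
    rw [List.length_cons, Finset.prod_range_succ']
    simp only [List.getD_cons_zero, List.getD_cons_succ, ih, List.prod_cons, mul_comm]

/-- Adding the product of a list of affine forms to a gadget: lists of length `≤ 1` have an
affine product (`exists_gadget_add_affine`), longer ones are paths
(`exists_gadget_add_prod`). Valiant 1979, §2. [cite: ValiantSTOC1979, §2] -/
theorem exists_gadget_add_listProd {g : MvPolynomial σ k} (l : List (MvPolynomial σ k))
    (hl : ∀ y ∈ l, y.totalDegree ≤ 1)
    (h : ∃ (ι : Type) (_ : Fintype ι) (_ : DecidableEq ι) (z : ι)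
      (M : Matrix ι ι (MvPolynomial σ k)),
      (∀ p q, (M p q).totalDegree ≤ 1) ∧ ∀ c, (M + Matrix.single z z c).det = c + g) :
    ∃ (ι : Type) (_ : Fintype ι) (_ : DecidableEq ι) (z : ι) (M : Matrix ι ι (MvPolynomial σ k)),
      (∀ p q, (M p q).totalDegree ≤ 1) ∧ ∀ c, (M + Matrix.single z z c).det = c + (g + l.prod) := by
  rcases l with _ | ⟨x, _ | ⟨x', rest⟩⟩
  · rw [List.prod_nil]
    exact exists_gadget_add_affine (by simp) h
  · rw [List.prod_cons, List.prod_nil, mul_one]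
    exact exists_gadget_add_affine (hl x (by simp)) h
  · have hy : ∀ i, ((x :: x' :: rest).getD i 1).totalDegree ≤ 1 := by
      intro i
      rw [List.getD_eq_getElem?_getD]
      by_cases hi : i < (x :: x' :: rest).length
      · rw [List.getElem?_eq_getElem hi, Option.getD_some]
        exact hl _ (List.getElem_mem hi)
      · rw [List.getElem?_eq_none (by omega), Option.getD_none]
        simp
    have := exists_gadget_add_prod (fun i => (x :: x' :: rest).getD i 1) hy rest.length h
    rwa [show rest.length + 2 = (x :: x' :: rest).length by simp, prod_range_getD_one] at this

/-- For every polynomial `f` and every list `l` of affine forms, `f · ∏ l` can be added to any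
gadget — by induction on `f` (`MvPolynomial.induction_on`): constants start a list
(`exists_gadget_add_listProd` for `C a :: l`), sums are added one after the other, and
`(f · X_n) · ∏ l = f · ∏ (X_n :: l)`. Valiant 1979, §2. [cite: ValiantSTOC1979, §2] -/
theorem exists_gadget_add_mul_listProd (f : MvPolynomial σ k) :
    ∀ (l : List (MvPolynomial σ k)), (∀ y ∈ l, y.totalDegree ≤ 1) →
      ∀ g : MvPolynomial σ k,
      (∃ (ι : Type) (_ : Fintype ι) (_ : DecidableEq ι) (z : ι)
        (M : Matrix ι ι (MvPolynomial σ k)),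
        (∀ p q, (M p q).totalDegree ≤ 1) ∧ ∀ c, (M + Matrix.single z z c).det = c + g) →
      ∃ (ι : Type) (_ : Fintype ι) (_ : DecidableEq ι) (z : ι)
        (M : Matrix ι ι (MvPolynomial σ k)),
        (∀ p q, (M p q).totalDegree ≤ 1) ∧
          ∀ c, (M + Matrix.single z z c).det = c + (g + f * l.prod) := by
  induction f using MvPolynomial.induction_on with
  | C a =>
    intro l hl g hg
    rw [← List.prod_cons]
    refine exists_gadget_add_listProd (C a :: l) ?_ hg
    simpa [totalDegree_C] using hl
  | add p q hp hq =>
    intro l hl g hg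
    rw [add_mul, ← add_assoc]
    exact hq l hl _ (hp l hl g hg)
  | mul_X p n hp =>
    intro l hl g hg
    rw [mul_assoc, ← List.prod_cons]
    refine hp (X n :: l) ?_ g hg
    simpa [(isHomogeneous_X k n).totalDegree_le] using hl

/-- **Discharge of `exists_hasDetRepr` (Valiant's universality of the determinant).** Every
polynomial over a commutative ring is the determinant of a square matrix of affine linear
forms: apply `exists_gadget_add_mul_listProd f []` to the `1 × 1` zero gadget and reindex along
`ι ≃ Fin (card ι)`. The matrix is the algebraic-branching-program matrix of the monomial
expansion of `f` (one closed path per monomial through the common vertex `z`), so its size is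
not Valiant's formula-size bound; only existence is asserted by the fact.
Valiant 1979, Thm. 1 and §2; Bürgisser 2000, Prop. 2.30 and §2.5. [cite: ValiantSTOC1979, Thm. 1] -/
theorem exists_hasDetRepr_holds : exists_hasDetRepr (k := k) (σ := σ) := by
  intro f
  obtain ⟨ι, _, _, z, M, hdeg, hdet⟩ :=
    exists_gadget_add_mul_listProd f [] (by simp) 0 exists_gadget_zero
  refine ⟨Fintype.card ι, Matrix.reindex (Fintype.equivFin ι) (Fintype.equivFin ι) M,
    fun i j => ?_, ?_⟩
  · rw [Matrix.reindex_apply, Matrix.submatrix_apply]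
    exact hdeg _ _
  · rw [Matrix.det_reindex_self]
    simpa using hdet 0

/-- **Discharge of `hasDetRepr_determinantalComplexity`**: the infimum defining `dc f` is
attained, since the defining set is nonempty (`exists_hasDetRepr_holds`).
Mignon–Ressayre 2004, §1. [cite: MignonRessayre2004, §1] -/
theorem hasDetRepr_determinantalComplexity_holds :
    hasDetRepr_determinantalComplexity (k := k) (σ := σ) :=
  fun f => Nat.sInf_mem (exists_hasDetRepr_holds f)

/-- **Discharge of `hasDetRepr_iff_determinantalComplexity_le`**: `HasDetRepr f m ↔ dc f ≤ m`
(`Nat.sInf_le`; conversely pad the attained representation, `HasDetRepr.mono_holds`).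
Mignon–Ressayre 2004, §1. [cite: MignonRessayre2004, §1] -/
theorem hasDetRepr_iff_determinantalComplexity_le_holds :
    hasDetRepr_iff_determinantalComplexity_le (k := k) (σ := σ) :=
  fun f _ => ⟨determinantalComplexity_le_of_hasDetRepr,
    fun h => HasDetRepr.mono_holds (hasDetRepr_determinantalComplexity_holds f) h⟩

end Universality

/-! ### Degree bound: `totalDegree f ≤ dc f` -/

section Degree

variable {k : Type*} [CommRing k] {σ : Type*}

/-- **Discharge of `totalDegree_le_of_hasDetRepr`**: the determinant of an `m × m` matrix of
affine linear forms has total degree `≤ m` — expand `det A = ∑_τ sign τ · ∏_i A (τ i) i`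
(`Matrix.det_apply'`); each product of `m` affine entries has total degree `≤ m` and the sign is
a constant. Mignon–Ressayre 2004, §1. [cite: MignonRessayre2004, §1] -/
theorem totalDegree_le_of_hasDetRepr_holds : totalDegree_le_of_hasDetRepr (k := k) (σ := σ) := by
  intro f m h
  obtain ⟨A, hA, rfl⟩ := h
  rw [Matrix.det_apply']
  refine totalDegree_finsetSum_le fun τ _ => ?_
  calc (((Equiv.Perm.sign τ : ℤ) : MvPolynomial σ k) * ∏ i, A (τ i) i).totalDegree
      ≤ ((Equiv.Perm.sign τ : ℤ) : MvPolynomial σ k).totalDegree +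
          (∏ i, A (τ i) i).totalDegree := totalDegree_mul _ _
    _ ≤ 0 + ∑ i, (A (τ i) i).totalDegree := by
        refine add_le_add (le_of_eq ?_) (totalDegree_finsetProd _ _)
        rw [← map_intCast (C : k →+* MvPolynomial σ k), totalDegree_C]
    _ ≤ 0 + ∑ _i : Fin m, 1 := by
        refine add_le_add le_rfl (Finset.sum_le_sum fun i _ => hA _ _)
    _ = m := by simp

/-- **Discharge of `totalDegree_le_determinantalComplexity`**: `totalDegree f ≤ dc f`, from
`totalDegree_le_of_hasDetRepr_holds` at the attained representation
(`hasDetRepr_determinantalComplexity_holds`, which rests on Valiant universality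
`exists_hasDetRepr_holds`). Mignon–Ressayre 2004, §1. [cite: MignonRessayre2004, §1] -/
theorem totalDegree_le_determinantalComplexity_holds :
    totalDegree_le_determinantalComplexity (k := k) (σ := σ) :=
  fun f => totalDegree_le_of_hasDetRepr_holds (hasDetRepr_determinantalComplexity_holds f)

end Degree

end Literature.Computability.AlgebraicComplexity

/-! ## Appendix (2026-08-14, ii): stability under projection

Discharges of the named facts `HasDetRepr.of_isProjection`, `IsDetProjection.hasDetRepr` and
`determinantalComplexity_le_of_isProjection` of `DeterminantalComplexity.lean`
(Bürgisser 2000, §2.5): substitute the projection into the affine matrix entrywise. The two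
ingredients are that ring homomorphisms commute with determinants (`AlgHom.map_det`) and that
substituting polynomials of total degree `≤ 1` for the variables does not raise the total degree
(`HasDetRepr.totalDegree_aeval_le_of_le_one`, a local copy of the folklore estimate, cf.
`totalDegree_aeval_le_of_forall_le_one` in `PowerSumNonvanishing.lean`, kept here so that this
file does not import the orbit-closure material).

Source: P. Bürgisser, *Completeness and Reduction in Algebraic Complexity Theory*, Springer 2000,
§2.1 (projections do not increase degree) and §2.5 (determinantal complexity; key
`Burgisser2000`); cf. P. Bürgisser, *Completeness classes in algebraic complexity theory*,
arXiv:2406.06217 (2024), Def. 2.35.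
-/

namespace Literature.Computability.AlgebraicComplexity

section OfIsProjection

variable {k : Type*} [CommRing k] {σ : Type*} {τ : Type*}

/-- Substituting polynomials of total degree `≤ 1` (variables, constants, affine linear forms)
for the variables of a polynomial does not raise its total degree: a monomial of degree `d` is
sent to a constant times a product of `d` factors of degree `≤ 1`
(Bürgisser 2000, §2.1: projections do not increase the degree). [folklore] -/
theorem HasDetRepr.totalDegree_aeval_le_of_le_one {ι : Type*} (a : ι → MvPolynomial τ k)
    (ha : ∀ i, (a i).totalDegree ≤ 1) (p : MvPolynomial ι k) :
    (aeval a p).totalDegree ≤ p.totalDegree := by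
  classical
  rw [p.as_sum, map_sum]
  refine (totalDegree_finsetSum _ _).trans (Finset.sup_le fun e he => ?_)
  rw [aeval_monomial, algebraMap_eq]
  refine (totalDegree_mul _ _).trans ?_
  rw [totalDegree_C, zero_add, Finsupp.prod]
  refine (totalDegree_finsetProd _ _).trans ?_
  refine le_trans (Finset.sum_le_sum fun i _ => (totalDegree_pow _ _).trans
    (Nat.mul_le_mul_left _ (ha i))) ?_
  simp only [mul_one]
  rw [← p.as_sum]
  exact le_totalDegree he

/-- **Discharge of `HasDetRepr.of_isProjection`.** If `f = det A` for an `m × m` matrix `A` of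
affine linear forms and `g = f(a₁, …, aₙ)` with every `aᵢ` a variable or a constant, then
`g = det (A(a₁, …, aₙ))` because ring homomorphisms commute with determinants
(`AlgHom.map_det`), and the substituted entries `(A i j)(a₁, …, aₙ)` are again affine, variables
and constants having total degree `≤ 1` (`HasDetRepr.totalDegree_aeval_le_of_le_one`). Hence a
projection `g` of `f` inherits every affine determinantal representation of `f`, of the same
size (Bürgisser 2000, §2.5). [cite: Burgisser2000, §2.5] -/
theorem HasDetRepr.of_isProjection_holds :
    HasDetRepr.of_isProjection (k := k) (σ := σ) (τ := τ) := by
  intro f g m h hg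
  obtain ⟨A, hA, rfl⟩ := h
  obtain ⟨a, ha, rfl⟩ := hg
  have ha1 : ∀ i, (a i).totalDegree ≤ 1 := fun i => by
    rcases ha i with ⟨j, hj⟩ | ⟨c, hc⟩
    · rw [hj]
      simpa [X, Finsupp.sum_single_index] using
        totalDegree_monomial_le (R := k) (Finsupp.single j 1) 1
    · rw [hc, totalDegree_C]
      exact Nat.zero_le _
  refine ⟨(aeval a).mapMatrix A, fun i j => ?_, (AlgHom.map_det _ _).symm⟩
  rw [AlgHom.mapMatrix_apply, Matrix.map_apply]
  exact (HasDetRepr.totalDegree_aeval_le_of_le_one a ha1 _).trans (hA i j)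

/-- **Discharge of `IsDetProjection.hasDetRepr`.** A projection of the generic determinant
`DET_m` is an affine determinantal representation of size `m`: apply
`HasDetRepr.of_isProjection_holds` to the tautological representation `DET_m = det (X i j)`
(`hasDetRepr_detPoly`) (Bürgisser 2000, §2.5). [cite: Burgisser2000, §2.5] -/
theorem IsDetProjection.hasDetRepr_holds : IsDetProjection.hasDetRepr (k := k) (σ := σ) :=
  fun {_} {m} h => HasDetRepr.of_isProjection_holds (hasDetRepr_detPoly m) h

/-- **Discharge of `determinantalComplexity_le_of_isProjection`.** `dc` is monotone under
projection: if `g` is a projection of `f` then `dc g ≤ dc f`, by transporting the attained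
representation of `f` (`hasDetRepr_determinantalComplexity_holds`, which rests on Valiant's
universality `exists_hasDetRepr_holds`) along the projection
(`HasDetRepr.of_isProjection_holds`) (Bürgisser 2000, §2.5). [cite: Burgisser2000, §2.5] -/
theorem determinantalComplexity_le_of_isProjection_holds :
    determinantalComplexity_le_of_isProjection (k := k) (σ := σ) (τ := τ) :=
  fun {f} {_} hg => determinantalComplexity_le_of_hasDetRepr
    (HasDetRepr.of_isProjection_holds (hasDetRepr_determinantalComplexity_holds f) hg)

end OfIsProjection

end Literature.Computability.AlgebraicComplexity

/-! ## Appendix (2026-08-14, iii): base change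

Discharge of the named fact `HasDetRepr.map` of `DeterminantalComplexity.lean`: an affine
determinantal representation of `f` over `k` pushes forward along any ring homomorphism
`φ : k →+* k'` to one of `MvPolynomial.map φ f`, of the same size (extension of scalars;
P. Bürgisser, *Completeness and reduction in algebraic complexity theory* (2000), §4.1,
key `Burgisser2000`). The proof is the one-line observation recorded in the fact's docstring:
apply `MvPolynomial.map φ` entrywise and use `RingHom.map_det`.
-/

namespace Literature.Computability.AlgebraicComplexity

section BaseChange

variable {k : Type*} [CommRing k] {σ : Type*}

/-- **Discharge of `HasDetRepr.map`** (base change of an affine determinantal representation):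
if `f = det A` with `A` an `m × m` matrix of affine entries over `k`, then the entrywise image
`A.map (MvPolynomial.map φ)` under `φ : k →+* k'` has affine entries — `map φ` can only delete
monomials (`MvPolynomial.support_map_subset`), so the total degree does not increase — and
determinant `map φ (det A) = map φ f` (`RingHom.map_det`). Bürgisser 2000, §4.1.
[cite: Burgisser2000, §4.1] -/
theorem HasDetRepr.map_holds : HasDetRepr.map (k := k) (σ := σ) := by
  intro k' _ f m h φ
  obtain ⟨A, hA, hdet⟩ := h
  refine ⟨A.map (MvPolynomial.map φ), fun i j => ?_, ?_⟩
  · rw [Matrix.map_apply]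
    exact (Finset.sup_mono (MvPolynomial.support_map_subset φ (A i j))).trans (hA i j)
  · rw [← RingHom.mapMatrix_apply, ← RingHom.map_det, hdet]

end BaseChange

end Literature.Computability.AlgebraicComplexity

/-! ## Appendix (2026-08-15, iv): Valiant universality in projection form, `dc f ≤ dpc f`

Discharge of the named fact `determinantalComplexity_le_detProjectionComplexity` of
`DeterminantalComplexity.lean` (Bürgisser 2000, §2.5): the determinantal complexity `dc f` is at
most Valiant's projection determinantal complexity `dpc f = min {m : f is a projection of DET_m}`.
A projection of `DET_m` is an affine determinantal representation of size `m`
(`IsDetProjection.hasDetRepr_holds`, Appendix ii), so the only point is that the infimum defining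
`dpc f` is not the junk value `sInf ∅ = 0`, i.e. the *projection form* of Valiant's universality
theorem: every polynomial is `det M` for a square matrix `M` whose entries are variables or
constants (Valiant 1979, Thm. 1: "`f` is a projection of `DET_{s+2}`"). The affine construction of
Appendix i (`exists_hasDetRepr_holds`) is not enough as it stands, because its path blocks carry
the negated affine forms `-y_i`, and `-X_v` is neither a variable nor a constant. Here the same
bordering lemma `det_pathBorder_add_single` is fed the weights `y₀ = (-1)^{t+1} a`,
`y_{j+1} = -X_{l_j}` (`j < t`), `y_{t+1} = -1` for a monomial `a X_{l_0} ⋯ X_{l_{t-1}}`: the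
matrix entries are then `0`, `1`, the variables `X_{l_j}` themselves (the superdiagonal `-y_{j+1}`)
and the constants `(-1)^t a`, `-1`, while the added path weight is
`∏_{i<t+2} y_i = (-1)^{t+1} a · (-1)^t ∏_j X_{l_j} · (-1) = a ∏_j X_{l_j}`. Induction on `f`
(`MvPolynomial.induction_on`, accumulating the list of variables of the current monomial) gives a
projection gadget for every `f`, hence `exists_isDetProjection`, the attained infimum
`isDetProjection_detProjectionComplexity`, and the discharge
`determinantalComplexity_le_detProjectionComplexity_holds`.

Sources: L. G. Valiant, *Completeness classes in algebra*, STOC 1979, Thm. 1 and §2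
(key `ValiantSTOC1979`); P. Bürgisser, *Completeness and Reduction in Algebraic Complexity
Theory*, Springer 2000, Prop. 2.30 and §2.5 (key `Burgisser2000`); P. Bürgisser, *Completeness
classes in algebraic complexity theory*, arXiv:2406.06217 (2024), Prop. 2.23 ("`f = det (A)` for
some matrix `A` with entries in `𝔽 ∪ X`") and Def. 2.35 (determinantal complexity).
-/

namespace Literature.Computability.AlgebraicComplexity

section ProjUniversality

variable {k : Type*} [CommRing k] {σ : Type*}

/-- The entries of the list of variables `X v, v ∈ l`, read with default `1`, are variables or
the constant `1`. [folklore] -/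
theorem getD_map_X (l : List σ) (j : ℕ) :
    (∃ v, (l.map X : List (MvPolynomial σ k)).getD j 1 = X v) ∨
      (l.map X : List (MvPolynomial σ k)).getD j 1 = 1 := by
  induction l generalizing j with
  | nil => exact Or.inr (by simp)
  | cons v l ih =>
    cases j with
    | zero => exact Or.inl ⟨v, by simp⟩
    | succ j => simpa using ih j

/-- The `1 × 1` zero matrix is a projection gadget for `0`. [folklore] -/
theorem exists_pgadget_zero :
    ∃ (ι : Type) (_ : Fintype ι) (_ : DecidableEq ι) (z : ι) (M : Matrix ι ι (MvPolynomial σ k)),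
      (∀ p q, (∃ v, M p q = X v) ∨ ∃ c, M p q = C c) ∧
        ∀ c, (M + Matrix.single z z c).det = c + 0 :=
  ⟨Unit, inferInstance, inferInstance, (), 0, fun _ _ => Or.inr ⟨0, by simp⟩, fun c => by
    simp [Matrix.det_unique]⟩

/-- **Projection gadgets: adding a monomial.** If `M` (entries variables or constants, `(z, z)`
cofactor `1`) is a gadget for `g`, then bordering it with the path block of
`det_pathBorder_add_single` for the weights `y₀ = (-1)^{t+1} a`, `y_{j+1} = -X_{l_j}` (`j < t`),
`y_{t+1} = -1` gives a gadget for `g + a · X_{l_0} ⋯ X_{l_{t-1}}` whose new entries are `0`, `1`,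
the variables `X_{l_j}` (superdiagonal `-y_{j+1}`) and the constants `-y₀`, `-1`: no variable is
negated, so the matrix stays a projection of the generic matrix. Valiant 1979, Thm. 1 and §2.
[cite: ValiantSTOC1979, Thm. 1] -/
theorem exists_pgadget_add_C_mul_prod {g : MvPolynomial σ k} (a : k) (l : List σ)
    (h : ∃ (ι : Type) (_ : Fintype ι) (_ : DecidableEq ι) (z : ι)
      (M : Matrix ι ι (MvPolynomial σ k)),
      (∀ p q, (∃ v, M p q = X v) ∨ ∃ c, M p q = C c) ∧
        ∀ c, (M + Matrix.single z z c).det = c + g) :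
    ∃ (ι : Type) (_ : Fintype ι) (_ : DecidableEq ι) (z : ι) (M : Matrix ι ι (MvPolynomial σ k)),
      (∀ p q, (∃ v, M p q = X v) ∨ ∃ c, M p q = C c) ∧
        ∀ c, (M + Matrix.single z z c).det = c + (g + C a * (l.map X).prod) := by
  obtain ⟨ι, _, _, z, M, hM, hdet⟩ := h
  -- the weights of the bordering path
  let y : ℕ → MvPolynomial σ k := fun i => match i with
    | 0 => C ((-1) ^ (l.length + 1) * a)
    | j + 1 => -((l.map X : List (MvPolynomial σ k)).getD j 1)
  have hy0 : y 0 = C ((-1) ^ (l.length + 1) * a) := rfl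
  have hys : ∀ j, y (j + 1) = -((l.map X : List (MvPolynomial σ k)).getD j 1) := fun j => rfl
  have hylast : y (l.length + 1) = -1 := by
    rw [hys, List.getD_eq_getElem?_getD, List.getElem?_eq_none (by simp), Option.getD_none]
  let U : Matrix (Fin (l.length + 1)) (Fin (l.length + 1)) (MvPolynomial σ k) :=
    Matrix.of fun p q => if (q : ℕ) = p then 1 else if (q : ℕ) = p + 1 then -y q else 0
  let W : Matrix (Fin (l.length + 1)) (Fin (l.length + 1)) (MvPolynomial σ k) :=
    Matrix.of fun p q => if (p : ℕ) ≤ q then ∏ i ∈ Finset.Ioc (p : ℕ) q, y i else 0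
  have hU : ∀ p q, U p q = if (q : ℕ) = p then 1 else if (q : ℕ) = p + 1 then -y q else 0 :=
    fun p q => rfl
  have hW : ∀ p q, W p q = if (p : ℕ) ≤ q then ∏ i ∈ Finset.Ioc (p : ℕ) q, y i else 0 :=
    fun p q => rfl
  have hprod : ∏ i ∈ Finset.range (l.length + 2), y i = C a * (l.map X).prod := by
    rw [Finset.prod_range_succ', hy0, Finset.prod_range_succ, hylast,
      Finset.prod_congr rfl fun j _ => hys j, Finset.prod_neg, Finset.card_range,
      ← List.length_map (f := (X : σ → MvPolynomial σ k)) (as := l), prod_range_getD_one,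
      List.length_map]
    simp only [C_mul, C_pow, C_neg, C_1]
    have h1 : ((-1 : MvPolynomial σ k)) ^ (l.length + 1) * ((-1) ^ l.length * -1) = 1 := by
      rw [← pow_succ, ← pow_add, ← two_mul, pow_mul, neg_one_sq, one_pow]
    calc _ = (-1 : MvPolynomial σ k) ^ (l.length + 1) * ((-1) ^ l.length * -1) *
          (C a * (l.map X).prod) := by ring
      _ = C a * (l.map X).prod := by rw [h1, one_mul]
  refine ⟨ι ⊕ Fin (l.length + 1), inferInstance, inferInstance, Sum.inl z,
    Matrix.fromBlocks M (Matrix.single z (0 : Fin (l.length + 1)) (-y 0))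
      (Matrix.single (Fin.last l.length) z (y (l.length + 1))) U, ?_, fun c => ?_⟩
  · rintro (p | p) (q | q)
    · rw [Matrix.fromBlocks_apply₁₁]
      exact hM p q
    · rw [Matrix.fromBlocks_apply₁₂, Matrix.single_apply]
      refine Or.inr ?_
      split_ifs
      · exact ⟨-((-1) ^ (l.length + 1) * a), by rw [hy0, C_neg]⟩
      · exact ⟨0, C_0.symm⟩
    · rw [Matrix.fromBlocks_apply₂₁, Matrix.single_apply]
      refine Or.inr ?_
      split_ifs
      · exact ⟨-1, by rw [hylast, C_neg, C_1]⟩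
      · exact ⟨0, C_0.symm⟩
    · rw [Matrix.fromBlocks_apply₂₂, hU]
      split_ifs with h1 h2
      · exact Or.inr ⟨1, C_1.symm⟩
      · rw [h2, hys, neg_neg]
        rcases getD_map_X (k := k) l p with ⟨v, hv⟩ | h1
        · exact Or.inl ⟨v, hv⟩
        · exact Or.inr ⟨1, by rw [h1, C_1]⟩
      · exact Or.inr ⟨0, C_0.symm⟩
  · rw [det_pathBorder_add_single M z y c hU hW, hdet, hprod]
    ring

/-- For every polynomial `f` and every list `l` of variables, `f · ∏_{v ∈ l} X_v` can be added to
any projection gadget — by induction on `f` (`MvPolynomial.induction_on`): a constant `C a`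
closes a monomial `a · ∏ X_v` (`exists_pgadget_add_C_mul_prod`), sums are added one after the
other, and `(f · X_n) · ∏_l X = f · ∏_{n :: l} X`. Valiant 1979, Thm. 1 and §2.
[cite: ValiantSTOC1979, Thm. 1] -/
theorem exists_pgadget_add_mul_prod (f : MvPolynomial σ k) :
    ∀ (l : List σ) (g : MvPolynomial σ k),
      (∃ (ι : Type) (_ : Fintype ι) (_ : DecidableEq ι) (z : ι)
        (M : Matrix ι ι (MvPolynomial σ k)),
        (∀ p q, (∃ v, M p q = X v) ∨ ∃ c, M p q = C c) ∧
          ∀ c, (M + Matrix.single z z c).det = c + g) →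
      ∃ (ι : Type) (_ : Fintype ι) (_ : DecidableEq ι) (z : ι)
        (M : Matrix ι ι (MvPolynomial σ k)),
        (∀ p q, (∃ v, M p q = X v) ∨ ∃ c, M p q = C c) ∧
          ∀ c, (M + Matrix.single z z c).det = c + (g + f * (l.map X).prod) := by
  induction f using MvPolynomial.induction_on with
  | C a =>
    intro l g hg
    exact exists_pgadget_add_C_mul_prod a l hg
  | add p q hp hq =>
    intro l g hg
    rw [add_mul, ← add_assoc]
    exact hq l _ (hp l g hg)
  | mul_X p n hp =>
    intro l g hg
    have := hp (n :: l) g hg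
    rwa [List.map_cons, List.prod_cons, ← mul_assoc] at this

/-- **Valiant's universality of the determinant, projection form.** Every polynomial `f` over a
commutative ring is a projection of some generic determinant `DET_m`: `f = det M` for a square
matrix `M` whose entries are variables or constants (apply `exists_pgadget_add_mul_prod f []` to
the zero gadget, reindex along `ι ≃ Fin (card ι)`, and note
`aeval (M i j) DET_m = det M` by `AlgHom.map_det` and `Matrix.mvPolynomialX_mapMatrix_aeval`).
The matrix is the branching-program matrix of the monomial expansion of `f`, so `m` is not
Valiant's formula-size bound `s + 2`; only existence is asserted. Valiant 1979, Thm. 1;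
Bürgisser 2000, Prop. 2.30 and §2.5; Bürgisser 2024 (arXiv:2406.06217), Prop. 2.23.
[cite: ValiantSTOC1979, Thm. 1] -/
theorem exists_isDetProjection (f : MvPolynomial σ k) : ∃ m, IsDetProjection f m := by
  obtain ⟨ι, _, _, z, M, hM, hdet⟩ := exists_pgadget_add_mul_prod f [] 0 exists_pgadget_zero
  refine ⟨Fintype.card ι,
    fun p => Matrix.reindex (Fintype.equivFin ι) (Fintype.equivFin ι) M p.1 p.2,
    fun p => hM _ _, ?_⟩
  rw [detPoly, AlgHom.map_det, Matrix.mvPolynomialX_mapMatrix_aeval, Matrix.det_reindex_self]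
  have h0 := hdet 0
  rw [Matrix.single_zero, add_zero, zero_add, zero_add, List.map_nil, List.prod_nil,
    mul_one] at h0
  exact h0.symm

/-- The set of sizes `m` with `f` a projection of `DET_m` is nonempty (`exists_isDetProjection`),
so Valiant's projection determinantal complexity of `f` is attained: `f` is a projection of
`DET_{dpc f}`. Valiant 1979, Thm. 1. [cite: ValiantSTOC1979, Thm. 1] -/
theorem isDetProjection_detProjectionComplexity (f : MvPolynomial σ k) :
    IsDetProjection f (detProjectionComplexity f) :=
  Nat.sInf_mem (exists_isDetProjection f)

/-- **Discharge of `determinantalComplexity_le_detProjectionComplexity`**: `dc f ≤ dpc f`. The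
infimum defining `dpc f` is attained (`isDetProjection_detProjectionComplexity`, resting on the
projection form of Valiant's universality `exists_isDetProjection`), and a projection of `DET_m`
is an affine determinantal representation of size `m` (`IsDetProjection.hasDetRepr_holds`), whence
`dc f ≤ dpc f` (`determinantalComplexity_le_of_hasDetRepr`). Bürgisser 2000, §2.5;
Bürgisser 2024 (arXiv:2406.06217), Def. 2.35 and Prop. 2.23. [cite: Burgisser2000, §2.5] -/
theorem determinantalComplexity_le_detProjectionComplexity_holds :
    determinantalComplexity_le_detProjectionComplexity (k := k) (σ := σ) :=
  fun f => determinantalComplexity_le_of_hasDetRepr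
    (IsDetProjection.hasDetRepr_holds (isDetProjection_detProjectionComplexity f))

end ProjUniversality

end Literature.Computability.AlgebraicComplexity
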